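import Summits.NavierStokesRegularity.NavierStokesRegularity.Theses.SqueezeCycle
import Summits.NavierStokesRegularity.NavierStokesRegularity.Theorems.SqueezeCycleExtremalBiaxialitySubcriticalOfLiouville
import Summits.NavierStokesRegularity.NavierStokesRegularity.Theorems.SqueezeCycleExtremalBiaxialitySubcriticalExtremal
import Summits.NavierStokesRegularity.NavierStokesRegularity.Theorems.SqueezeCycleExtremalBiaxialitySubcriticalStretchRecordAttained
import Summits.NavierStokesRegularity.NavierStokesRegularity.Theorems.SqueezeCycleExtremalBiaxialitySubcriticalStretchRecordBudget
import Summits.NavierStokesRegularity.NavierStokesRegularity.Theorems.SqueezeCycleExtremalBiaxialitySubcriticalPayerTomography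
import Summits.NavierStokesRegularity.NavierStokesRegularity.Theorems.SqueezeCycleExtremalBiaxialitySubcriticalNoSlackStretching
import Summits.NavierStokesRegularity.NavierStokesRegularity.Theorems.SqueezeCycleMustSqueeze
import Summits.NavierStokesRegularity.NavierStokesRegularity.Theorems.ExtremalBiaxialitySubcritical.Negative.NoSlack
import Literature.Analysis.FluidPDE.TypeIAncientMild
import Literature.Analysis.FluidPDE.TypeIAncientMildClassical
import Literature.Analysis.FluidPDE.LerayGaugeStrainSpectrum
import Literature.Analysis.FluidPDE.DeviatoricHessian
import Literature.Analysis.FluidPDE.ClassicalSolution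
import HarnessLib

/-!
# Route `SqueezeCycle`, crux `ExtremalBiaxialitySubcritical` — line `oseen-shell-polar-tomography`: the typed reduction

Helper file for item `stmt-NavierStokesRegularity-11609`
(`Summit.NavierStokesRegularity.NavierStokesRegularity.Theses.SqueezeCycle.ExtremalBiaxialitySubcritical`),
line `oseen-shell-polar-tomography` (second line lead). Four of the line's six registered stubs are
theorems of the tree (`stub_stretchRecordAttained` p81985, `stub_noSlackStretching`,
`stub_stretchRecordBudget` p80708, `stub_payerTomography` p91020). This file records, sorry-free,
what the remaining two carry:

* `extremalBiaxialitySubcritical_of_coaxialFeederExclusion_of_noPancakeRecord` — **the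
  composition**: the crux follows from the two open stubs `stub_coaxialFeederExclusion` (verbatim)
  and `stub_noPancakeRecord` RESTRICTED to `m > 1/3` (for `m ≤ 1/3` the inequality `3m ≤ M` is free:
  the class is nontrivial, so the no-slack Liouville theorem gives `M ≥ 1 ≥ 3m`). Proof = the
  registered skeleton `Lines/oseen-shell-polar-tomography.lean` with the four landed stubs inlined.
* `coaxialFeederExclusion_of_squeezeLiouville`, `noPancakeRecord_of_squeezeLiouville` — **both open
  stubs follow from the route target** `SqueezeLiouville` (vacuously: a trivial class has no
  stretching record with `M ≥ 1`, and no squeeze record with `m ≥ 1/8`). So neither is refutable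
  short of a nontrivial Type-I ancient element (¬X).
* `extremalBiaxialitySubcritical_iff_coaxialFeederExclusion_and_noPancakeRecord` — with the proved
  crux `MustSqueeze` (`crux_iff_squeezeLiouville`), **the pair of open stubs is EQUIVALENT to the
  crux** (and to X): the line partitions the Type-I Liouville problem by the ratio of the class-wide
  stretching maximum `M*` to the squeeze maximum `m*` (`stub_coaxialFeederExclusion` can hold only
  vacuously, since at a genuine record `stub_stretchRecordBudget` + `stub_payerTomography` give the
  opposite inequality `(−t₁)²I(K) + V ≥ bill − ε(K)`; it says "no nontrivial class has
  `M* ≥ 3·max(m*, 1/8)`", while `stub_noPancakeRecord` says "no nontrivial class with `m* > 1/3` has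
  `M* < 3m*`"). Neither half comes with a mechanism; this is a partition, not a reduction.
-/

noncomputable section

open MeasureTheory Set Filter Topology
open scoped RealInnerProductSpace Matrix

set_option linter.dupNamespace false

namespace Summit.NavierStokesRegularity.NavierStokesRegularity.Theorems

open Literature.Analysis.FluidPDE
open Summit.NavierStokesRegularity.NavierStokesRegularity.Theses
open Summit.NavierStokesRegularity.NavierStokesRegularity.Theorems.ExtremalBiaxialitySubcritical.Negative

/-- **The composition of line `oseen-shell-polar-tomography`**: the crux from the two open stubs —
`stub_coaxialFeederExclusion` verbatim and `stub_noPancakeRecord` restricted to `m > 1/3` — over the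
four landed ones. Suppose `m ≥ 1/8` at an extremal configuration; take a class-wide stretching
record `(u₁,t₁,x₁,e₁,M)` (`stub_stretchRecordAttained`); `M ≥ 1` by no slack
(`stub_noSlackStretching`: otherwise `u ≡ 0` and `m ≤ 0`); `3m ≤ M` (free if `m ≤ 1/3`, else the
second hypothesis); the shortfall `δ` of the first hypothesis, the tomography radius `K` at
`ε = δ/2` (`stub_payerTomography`), a classical pressure of `u₁` on `(2t₁, 0)`
(`IsTypeIAncientMild.exists_isClassicalNSSolutionOn_Ioo`) and the budget
(`stub_stretchRecordBudget`) are contradictory. [folklore] -/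
theorem extremalBiaxialitySubcritical_of_coaxialFeederExclusion_of_noPancakeRecord :
    (∀ (C m : ℝ) (u₁ : ℝ → EuclideanSpace ℝ (Fin 3) → EuclideanSpace ℝ (Fin 3)) (t₁ : ℝ) (x₁ e₁ : EuclideanSpace ℝ (Fin 3)) (M : ℝ), ((IsTypeIAncientMild C u₁ ∧ (∀ (x₀ : EuclideanSpace ℝ (Fin 3)) (t₀ r : ℝ), t₀ ≤ 0 → 0 < r → (∀ t, t₀ - r^2 < t → t < t₀ → r⁻¹ * ∫ x in Metric.ball x₀ r, ‖u₁ t x‖^2 ≤ C) ∧ r⁻¹ * ∫ t in Set.Ioo (t₀ - r^2) t₀, ∫ x in Metric.ball x₀ r, ‖fderiv ℝ (u₁ t) x‖^2 ≤ C)) ∧ t₁ < 0 ∧ ‖e₁‖ = 1 ∧ (-t₁) * inner ℝ (fderiv ℝ (u₁ t₁) x₁ e₁) e₁ = M ∧ (∀ v : ℝ → EuclideanSpace ℝ (Fin 3) → EuclideanSpace ℝ (Fin 3), (IsTypeIAncientMild C v ∧ (∀ (x₀ : EuclideanSpace ℝ (Fin 3)) (t₀ r : ℝ), t₀ ≤ 0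 → 0 < r → (∀ t, t₀ - r^2 < t → t < t₀ → r⁻¹ * ∫ x in Metric.ball x₀ r, ‖v t x‖^2 ≤ C) ∧ r⁻¹ * ∫ t in Set.Ioo (t₀ - r^2) t₀, ∫ x in Metric.ball x₀ r, ‖fderiv ℝ (v t) x‖^2 ≤ C)) → ∀ t < 0, ∀ (x e : EuclideanSpace ℝ (Fin 3)), ‖e‖ = 1 → (-t) * inner ℝ (fderiv ℝ (v t) x e) e ≤ M)) → (∀ v : ℝ → EuclideanSpace ℝ (Fin 3) → EuclideanSpace ℝ (Fin 3), (IsTypeIAncientMild C v ∧ (∀ (x₀ : EuclideanSpace ℝ (Fin 3)) (t₀ r : ℝ), t₀ ≤ 0 → 0 < r → (∀ t, t₀ - r^2 < t → t < t₀ → r⁻¹ * ∫ x in Metric.ball x₀ r, ‖v t x‖^2 ≤ C) ∧ r⁻¹ * ∫ t in Set.Ioo (t₀ - r^2) t₀, ∫ x in Metric.ball x₀ r, ‖fderiv ℝ (v t) x‖^2 ≤ C)) → ∀ t < 0, ∀ x : EuclideanSpace ℝ (Fin 3), lerayMiddleStrain v t x ≤ m) → 1 / 8 ≤ m → 3 *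 m ≤ M → 1 ≤ M → ∃ δ : ℝ, 0 < δ ∧ ∀ K : ℝ, 1 ≤ K → (-t₁) ^ 2 * (∫ z in Metric.ball (0 : EuclideanSpace ℝ (Fin 3)) (K * Real.sqrt (-t₁)), (3 * inner ℝ z e₁ ^ 2 - ‖z‖ ^ 2) / (4 * Real.pi * ‖z‖ ^ 5) * (LinearMap.trace ℝ (EuclideanSpace ℝ (Fin 3)) ((fderiv ℝ (u₁ t₁) x₁).comp (fderiv ℝ (u₁ t₁) x₁)).toLinearMap - LinearMap.trace ℝ (EuclideanSpace ℝ (Fin 3)) ((fderiv ℝ (u₁ t₁) (x₁ - z)).comp (fderiv ℝ (u₁ t₁) (x₁ - z))).toLinearMap)) + ((-t₁) ^ 2 * ‖curl (u₁ t₁) x₁‖ ^ 2 - ((-t₁) * inner ℝ (curl (u₁ t₁) x₁) e₁) ^ 2) / 12 - ((-t₁) * inner ℝ (curl (u₁ t₁) x₁) e₁) ^ 2 / 6 ≤ M ^ 2 / 3 + M * (1 - 2 * m / 3) - 2 * m ^ 2 / 3 - δ) → (∀ (C m : ℝ) (u : ℝ → EuclideanSpace ℝ (Fin 3) → EuclideanSpace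 ℝ (Fin 3)) (t₀ : ℝ) (x₀ : EuclideanSpace ℝ (Fin 3)), t₀ < 0 → (IsTypeIAncientMild C u ∧ (∀ (x₀ : EuclideanSpace ℝ (Fin 3)) (t₀ r : ℝ), t₀ ≤ 0 → 0 < r → (∀ t, t₀ - r^2 < t → t < t₀ → r⁻¹ * ∫ x in Metric.ball x₀ r, ‖u t x‖^2 ≤ C) ∧ r⁻¹ * ∫ t in Set.Ioo (t₀ - r^2) t₀, ∫ x in Metric.ball x₀ r, ‖fderiv ℝ (u t) x‖^2 ≤ C)) → m ≤ lerayMiddleStrain u t₀ x₀ → (∀ v : ℝ → EuclideanSpace ℝ (Fin 3) → EuclideanSpace ℝ (Fin 3), (IsTypeIAncientMild C v ∧ (∀ (x₀ : EuclideanSpace ℝ (Fin 3)) (t₀ r : ℝ), t₀ ≤ 0 → 0 < r → (∀ t, t₀ - r^2 < t → t < t₀ → r⁻¹ * ∫ x in Metric.ball x₀ r, ‖v t x‖^2 ≤ C) ∧ r⁻¹ * ∫ t in Set.Ioo (t₀ - r^2) t₀, ∫ x in Metric.ball x₀ r, ‖fderiv ℝ (v t) x‖^2 ≤ C)) → ∀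 t < 0, ∀ x : EuclideanSpace ℝ (Fin 3), lerayMiddleStrain v t x ≤ m) → 1 / 8 ≤ m → 1 / 3 < m → ∀ (u₁ : ℝ → EuclideanSpace ℝ (Fin 3) → EuclideanSpace ℝ (Fin 3)) (t₁ : ℝ) (x₁ e₁ : EuclideanSpace ℝ (Fin 3)) (M : ℝ), ((IsTypeIAncientMild C u₁ ∧ (∀ (x₀ : EuclideanSpace ℝ (Fin 3)) (t₀ r : ℝ), t₀ ≤ 0 → 0 < r → (∀ t, t₀ - r^2 < t → t < t₀ → r⁻¹ * ∫ x in Metric.ball x₀ r, ‖u₁ t x‖^2 ≤ C) ∧ r⁻¹ * ∫ t in Set.Ioo (t₀ - r^2) t₀, ∫ x in Metric.ball x₀ r, ‖fderiv ℝ (u₁ t) x‖^2 ≤ C)) ∧ t₁ < 0 ∧ ‖e₁‖ = 1 ∧ (-t₁) * inner ℝ (fderiv ℝ (u₁ t₁) x₁ e₁) e₁ = M ∧ (∀ v : ℝ → EuclideanSpace ℝ (Fin 3) → EuclideanSpace ℝ (Fin 3), (IsTypeIAncientMild C v ∧ (∀ (x₀ : EuclideanSpace ℝ (Fin 3)) (t₀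 r : ℝ), t₀ ≤ 0 → 0 < r → (∀ t, t₀ - r^2 < t → t < t₀ → r⁻¹ * ∫ x in Metric.ball x₀ r, ‖v t x‖^2 ≤ C) ∧ r⁻¹ * ∫ t in Set.Ioo (t₀ - r^2) t₀, ∫ x in Metric.ball x₀ r, ‖fderiv ℝ (v t) x‖^2 ≤ C)) → ∀ t < 0, ∀ (x e : EuclideanSpace ℝ (Fin 3)), ‖e‖ = 1 → (-t) * inner ℝ (fderiv ℝ (v t) x e) e ≤ M)) → 3 * m ≤ M) → Summit.NavierStokesRegularity.NavierStokesRegularity.Theses.SqueezeCycle.ExtremalBiaxialitySubcritical := by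
  intro hCF hNP C m u t₀ x₀ ht₀ hu hGE hmax
  by_contra hm
  replace hm : 1 / 8 ≤ m := not_lt.1 hm
  obtain ⟨hΛeq, hΛle⟩ := extremal_lerayMiddleStrain_eq ht₀ hu hGE hmax
  obtain ⟨h1, h2, h3, h4, h5⟩ := hu
  have hK : IsTypeIAncientMild C u := isTypeIAncientMild_of_squeezeClass h1 h2 h3 h4
  have hΛmax : ∀ v : ℝ → EuclideanSpace ℝ (Fin 3) → EuclideanSpace ℝ (Fin 3),
      (IsTypeIAncientMild C v ∧ (∀ (x₀ : EuclideanSpace ℝ (Fin 3)) (t₀ r : ℝ), t₀ ≤ 0 → 0 < r → (∀ t, t₀ - r^2 < t → t < t₀ → r⁻¹ * ∫ x in Metric.ball x₀ r, ‖v t x‖^2 ≤ C) ∧ r⁻¹ * ∫ t in Set.Ioo (t₀ - r^2) t₀, ∫ x in Metric.ball x₀ r, ‖fderiv ℝ (v t) x‖^2 ≤ C)) →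
      ∀ t < 0, ∀ x : EuclideanSpace ℝ (Fin 3), lerayMiddleStrain v t x ≤ m := by
    rintro v ⟨hv, hve⟩ t ht x
    obtain ⟨a1, a2, a3, a4⟩ := isTypeIAncientMild_iff.1 hv
    exact hΛle v ⟨a1, a2, a3, a4, hve⟩ t ht x
  have hΛ0 : m ≤ lerayMiddleStrain u t₀ x₀ := hΛeq.ge
  -- 1. a class-wide stretching record
  obtain ⟨u₁, t₁, x₁, e₁, M, hrec⟩ := stub_stretchRecordAttained C u ⟨hK, h5⟩
  obtain ⟨⟨hK₁, h5₁⟩, ht₁, he₁, hMeq, hMmax⟩ := hrec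
  -- 2. no slack: `M ≥ 1`
  have hM1 : 1 ≤ M := by
    by_contra hM
    replace hM : M < 1 := not_le.1 hM
    have hz : ∀ x, u t₀ x = 0 := fun x =>
      stub_noSlackStretching C u hK (1 - M) (by linarith)
        (fun t ht x e he => by
          have h := hMmax u ⟨hK, h5⟩ t ht x e he
          linarith) t₀ ht₀ x
    have hm0 : m ≤ 0 := nonpos_of_twoFrame_lower_of_slice_zero hz hGE
    linarith
  -- 3. `3m ≤ M`: free for `m ≤ 1/3`, the second open stub otherwise
  have h3m : 3 * m ≤ M := by
    by_cases hm3 : m ≤ 1 / 3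
    · linarith
    · exact hNP C m u t₀ x₀ ht₀ ⟨hK, h5⟩ hΛ0 hΛmax hm (not_le.1 hm3) u₁ t₁ x₁ e₁ M
        ⟨⟨hK₁, h5₁⟩, ht₁, he₁, hMeq, hMmax⟩
  -- 6. the shortfall, 5. the tomography radius, the pressure, 4. the budget
  obtain ⟨δ, hδ, hfeed⟩ := hCF C m u₁ t₁ x₁ e₁ M ⟨⟨hK₁, h5₁⟩, ht₁, he₁, hMeq, hMmax⟩ hΛmax hm h3m hM1
  obtain ⟨K, hK1, htomo⟩ := stub_payerTomography C (δ / 2) (by positivity)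
  have h2t₁ : 2 * t₁ < 0 := by linarith
  obtain ⟨p, hp⟩ := hK₁.exists_isClassicalNSSolutionOn_Ioo h2t₁
  have hbud := stub_stretchRecordBudget C m u₁ hK₁ t₁ ht₁ x₁ e₁ he₁ M hMeq
    (fun t ht x => hMmax u₁ ⟨hK₁, h5₁⟩ t ht x e₁ he₁)
    (fun e' he' => hMmax u₁ ⟨hK₁, h5₁⟩ t₁ ht₁ x₁ e' he')
    (hΛmax u₁ ⟨hK₁, h5₁⟩ t₁ ht₁ x₁) (2 * t₁) (by linarith) p hp
  have htom := htomo u₁ hK₁ (2 * t₁) p hp t₁ (by linarith) ht₁ x₁ e₁ he₁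
  have hsh := hfeed K hK1
  rw [abs_le] at htom
  linarith [htom.1, htom.2]

/-- **`stub_coaxialFeederExclusion` follows from the route target** (vacuously): under
`SqueezeLiouville` the record holder `u₁` vanishes on `t < 0`, so the record value is `M = 0`,
against `1 ≤ M`. Hence the stub is not refutable short of a nontrivial Type-I ancient element
(¬X). [folklore] -/
theorem coaxialFeederExclusion_of_squeezeLiouville :
    Summit.NavierStokesRegularity.NavierStokesRegularity.Theses.SqueezeCycle.SqueezeLiouville → ∀ (C m : ℝ) (u₁ : ℝ → EuclideanSpace ℝ (Fin 3) → EuclideanSpace ℝ (Fin 3)) (t₁ : ℝ) (x₁ e₁ : EuclideanSpace ℝ (Fin 3)) (M : ℝ), ((IsTypeIAncientMild C u₁ ∧ (∀ (x₀ : EuclideanSpace ℝ (Fin 3)) (t₀ r : ℝ), t₀ ≤ 0 → 0 < r → (∀ t, t₀ - r^2 < t → t < t₀ → r⁻¹ * ∫ x in Metric.ball x₀ r, ‖u₁ t x‖^2 ≤ C) ∧ r⁻¹ * ∫ t in Set.Ioo (t₀ - r^2) t₀, ∫ x in Metric.ball x₀ r, ‖fderiv ℝ (u₁ t) x‖^2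 ≤ C)) ∧ t₁ < 0 ∧ ‖e₁‖ = 1 ∧ (-t₁) * inner ℝ (fderiv ℝ (u₁ t₁) x₁ e₁) e₁ = M ∧ (∀ v : ℝ → EuclideanSpace ℝ (Fin 3) → EuclideanSpace ℝ (Fin 3), (IsTypeIAncientMild C v ∧ (∀ (x₀ : EuclideanSpace ℝ (Fin 3)) (t₀ r : ℝ), t₀ ≤ 0 → 0 < r → (∀ t, t₀ - r^2 < t → t < t₀ → r⁻¹ * ∫ x in Metric.ball x₀ r, ‖v t x‖^2 ≤ C) ∧ r⁻¹ * ∫ t in Set.Ioo (t₀ - r^2) t₀, ∫ x in Metric.ball x₀ r, ‖fderiv ℝ (v t) x‖^2 ≤ C)) → ∀ t < 0, ∀ (x e : EuclideanSpace ℝ (Fin 3)), ‖e‖ = 1 → (-t) * inner ℝ (fderiv ℝ (v t) x e) e ≤ M)) → (∀ v : ℝ → EuclideanSpace ℝ (Fin 3) → EuclideanSpace ℝ (Fin 3), (IsTypeIAncientMild C v ∧ (∀ (x₀ : EuclideanSpace ℝ (Fin 3)) (t₀ r : ℝ), t₀ ≤ 0 → 0 < r → (∀ t, t₀ - r^2 <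 t → t < t₀ → r⁻¹ * ∫ x in Metric.ball x₀ r, ‖v t x‖^2 ≤ C) ∧ r⁻¹ * ∫ t in Set.Ioo (t₀ - r^2) t₀, ∫ x in Metric.ball x₀ r, ‖fderiv ℝ (v t) x‖^2 ≤ C)) → ∀ t < 0, ∀ x : EuclideanSpace ℝ (Fin 3), lerayMiddleStrain v t x ≤ m) → 1 / 8 ≤ m → 3 * m ≤ M → 1 ≤ M → ∃ δ : ℝ, 0 < δ ∧ ∀ K : ℝ, 1 ≤ K → (-t₁) ^ 2 * (∫ z in Metric.ball (0 : EuclideanSpace ℝ (Fin 3)) (K * Real.sqrt (-t₁)), (3 * inner ℝ z e₁ ^ 2 - ‖z‖ ^ 2) / (4 * Real.pi * ‖z‖ ^ 5) * (LinearMap.trace ℝ (EuclideanSpace ℝ (Fin 3)) ((fderiv ℝ (u₁ t₁) x₁).comp (fderiv ℝ (u₁ t₁) x₁)).toLinearMap - LinearMap.trace ℝ (EuclideanSpace ℝ (Fin 3)) ((fderiv ℝ (u₁ t₁) (x₁ - z)).comp (fderiv ℝ (u₁ t₁) (x₁ - z))).toLinearMap)) + ((-t₁) ^ 2 * ‖curl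 (u₁ t₁) x₁‖ ^ 2 - ((-t₁) * inner ℝ (curl (u₁ t₁) x₁) e₁) ^ 2) / 12 - ((-t₁) * inner ℝ (curl (u₁ t₁) x₁) e₁) ^ 2 / 6 ≤ M ^ 2 / 3 + M * (1 - 2 * m / 3) - 2 * m ^ 2 / 3 - δ := by
  intro hL C m u₁ t₁ x₁ e₁ M hrec _ _ _ hM1
  exfalso
  obtain ⟨⟨hK₁, h5₁⟩, ht₁, -, hMeq, -⟩ := hrec
  obtain ⟨a1, a2, a3, a4⟩ := isTypeIAncientMild_iff.1 hK₁
  have hz : ∀ x, u₁ t₁ x = 0 := fun x => hL C u₁ ⟨a1, a2, a3, a4, h5₁⟩ t₁ ht₁ x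
  have hu0 : u₁ t₁ = fun _ => (0 : EuclideanSpace ℝ (Fin 3)) := funext hz
  have hM0 : M = 0 := by
    rw [hu0] at hMeq
    simpa using hMeq.symm
  linarith

/-- **`stub_noPancakeRecord` follows from the route target** (vacuously; stated for the registered
form, all `m ≥ 1/8`): under `SqueezeLiouville` the squeeze-record holder `u` vanishes on `t < 0`, so
`m ≤ Λ_u(t₀,x₀)` forces `m ≤ 0` (`nonpos_of_twoFrame_lower_of_slice_zero`), against `1/8 ≤ m`.
[folklore] -/
theorem noPancakeRecord_of_squeezeLiouville :
    Summit.NavierStokesRegularity.NavierStokesRegularity.Theses.SqueezeCycle.SqueezeLiouville → ∀ (C m : ℝ) (u : ℝ → EuclideanSpace ℝ (Fin 3) → EuclideanSpace ℝ (Fin 3)) (t₀ : ℝ) (x₀ : EuclideanSpace ℝ (Fin 3)), t₀ < 0 → (IsTypeIAncientMild C u ∧ (∀ (x₀ : EuclideanSpace ℝ (Fin 3)) (t₀ r : ℝ), t₀ ≤ 0 → 0 < r → (∀ t, t₀ - r^2 < t → t < t₀ → r⁻¹ * ∫ x in Metric.ball x₀ r, ‖u t x‖^2 ≤ C) ∧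 r⁻¹ * ∫ t in Set.Ioo (t₀ - r^2) t₀, ∫ x in Metric.ball x₀ r, ‖fderiv ℝ (u t) x‖^2 ≤ C)) → m ≤ lerayMiddleStrain u t₀ x₀ → (∀ v : ℝ → EuclideanSpace ℝ (Fin 3) → EuclideanSpace ℝ (Fin 3), (IsTypeIAncientMild C v ∧ (∀ (x₀ : EuclideanSpace ℝ (Fin 3)) (t₀ r : ℝ), t₀ ≤ 0 → 0 < r → (∀ t, t₀ - r^2 < t → t < t₀ → r⁻¹ * ∫ x in Metric.ball x₀ r, ‖v t x‖^2 ≤ C) ∧ r⁻¹ * ∫ t in Set.Ioo (t₀ - r^2) t₀, ∫ x in Metric.ball x₀ r, ‖fderiv ℝ (v t) x‖^2 ≤ C)) → ∀ t < 0, ∀ x : EuclideanSpace ℝ (Fin 3), lerayMiddleStrain v t x ≤ m) → 1 / 8 ≤ m → ∀ (u₁ : ℝ → EuclideanSpace ℝ (Fin 3) → EuclideanSpace ℝ (Fin 3)) (t₁ : ℝ) (x₁ e₁ : EuclideanSpace ℝ (Fin 3)) (M : ℝ), ((IsTypeIAncientMild C u₁ ∧ (∀ (x₀ : EuclideanSpace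 ℝ (Fin 3)) (t₀ r : ℝ), t₀ ≤ 0 → 0 < r → (∀ t, t₀ - r^2 < t → t < t₀ → r⁻¹ * ∫ x in Metric.ball x₀ r, ‖u₁ t x‖^2 ≤ C) ∧ r⁻¹ * ∫ t in Set.Ioo (t₀ - r^2) t₀, ∫ x in Metric.ball x₀ r, ‖fderiv ℝ (u₁ t) x‖^2 ≤ C)) ∧ t₁ < 0 ∧ ‖e₁‖ = 1 ∧ (-t₁) * inner ℝ (fderiv ℝ (u₁ t₁) x₁ e₁) e₁ = M ∧ (∀ v : ℝ → EuclideanSpace ℝ (Fin 3) → EuclideanSpace ℝ (Fin 3), (IsTypeIAncientMild C v ∧ (∀ (x₀ : EuclideanSpace ℝ (Fin 3)) (t₀ r : ℝ), t₀ ≤ 0 → 0 < r → (∀ t, t₀ - r^2 < t → t < t₀ → r⁻¹ * ∫ x in Metric.ball x₀ r, ‖v t x‖^2 ≤ C) ∧ r⁻¹ * ∫ t in Set.Ioo (t₀ - r^2) t₀, ∫ x in Metric.ball x₀ r, ‖fderiv ℝ (v t) x‖^2 ≤ C)) → ∀ t < 0, ∀ (x e : EuclideanSpace ℝ (Fin 3)),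 ‖e‖ = 1 → (-t) * inner ℝ (fderiv ℝ (v t) x e) e ≤ M)) → 3 * m ≤ M := by
  intro hL C m u t₀ x₀ ht₀ hu hΛ0 _ hm
  intros
  exfalso
  obtain ⟨hK, h5⟩ := hu
  obtain ⟨a1, a2, a3, a4⟩ := isTypeIAncientMild_iff.1 hK
  have hz : ∀ x, u t₀ x = 0 := fun x => hL C u ⟨a1, a2, a3, a4, h5⟩ t₀ ht₀ x
  have hm0 : m ≤ 0 :=
    nonpos_of_twoFrame_lower_of_slice_zero hz ((le_lerayMiddleStrain_iff ht₀ m).1 hΛ0)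
  linarith

/-- **The two open stubs of the line are, together, EQUIVALENT to the crux** (hence to the route
target X, `crux_iff_squeezeLiouville` with the proved crux `MustSqueeze`): forward through
`SqueezeLiouville` (both stubs hold vacuously), backward by the composition. Line
`oseen-shell-polar-tomography` is therefore closed modulo a PARTITION of the Type-I Liouville
problem (by the ratio of the class-wide stretching maximum to the squeeze maximum, `M* ≷ 3m*`),
not modulo a smaller statement. [folklore] -/
theorem extremalBiaxialitySubcritical_iff_coaxialFeederExclusion_and_noPancakeRecord :
    Summit.NavierStokesRegularity.NavierStokesRegularity.Theses.SqueezeCycle.ExtremalBiaxialitySubcritical ↔ ((∀ (C m : ℝ) (u₁ : ℝ → EuclideanSpace ℝ (Fin 3) → EuclideanSpace ℝ (Fin 3)) (t₁ : ℝ) (x₁ e₁ : EuclideanSpace ℝ (Fin 3)) (M : ℝ), ((IsTypeIAncientMild C u₁ ∧ (∀ (x₀ : EuclideanSpace ℝ (Fin 3)) (t₀ r : ℝ), t₀ ≤ 0 → 0 < r → (∀ t, t₀ - r^2 < t → t < t₀ → r⁻¹ * ∫ x in Metric.ball x₀ r, ‖u₁ t x‖^2 ≤ C) ∧ r⁻¹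 * ∫ t in Set.Ioo (t₀ - r^2) t₀, ∫ x in Metric.ball x₀ r, ‖fderiv ℝ (u₁ t) x‖^2 ≤ C)) ∧ t₁ < 0 ∧ ‖e₁‖ = 1 ∧ (-t₁) * inner ℝ (fderiv ℝ (u₁ t₁) x₁ e₁) e₁ = M ∧ (∀ v : ℝ → EuclideanSpace ℝ (Fin 3) → EuclideanSpace ℝ (Fin 3), (IsTypeIAncientMild C v ∧ (∀ (x₀ : EuclideanSpace ℝ (Fin 3)) (t₀ r : ℝ), t₀ ≤ 0 → 0 < r → (∀ t, t₀ - r^2 < t → t < t₀ → r⁻¹ * ∫ x in Metric.ball x₀ r, ‖v t x‖^2 ≤ C) ∧ r⁻¹ * ∫ t in Set.Ioo (t₀ - r^2) t₀, ∫ x in Metric.ball x₀ r, ‖fderiv ℝ (v t) x‖^2 ≤ C)) → ∀ t < 0, ∀ (x e : EuclideanSpace ℝ (Fin 3)), ‖e‖ = 1 → (-t) * inner ℝ (fderiv ℝ (v t) x e) e ≤ M)) → (∀ v : ℝ → EuclideanSpace ℝ (Fin 3) → EuclideanSpace ℝ (Fin 3), (IsTypeIAncientMild C v ∧ (∀ (x₀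 : EuclideanSpace ℝ (Fin 3)) (t₀ r : ℝ), t₀ ≤ 0 → 0 < r → (∀ t, t₀ - r^2 < t → t < t₀ → r⁻¹ * ∫ x in Metric.ball x₀ r, ‖v t x‖^2 ≤ C) ∧ r⁻¹ * ∫ t in Set.Ioo (t₀ - r^2) t₀, ∫ x in Metric.ball x₀ r, ‖fderiv ℝ (v t) x‖^2 ≤ C)) → ∀ t < 0, ∀ x : EuclideanSpace ℝ (Fin 3), lerayMiddleStrain v t x ≤ m) → 1 / 8 ≤ m → 3 * m ≤ M → 1 ≤ M → ∃ δ : ℝ, 0 < δ ∧ ∀ K : ℝ, 1 ≤ K → (-t₁) ^ 2 * (∫ z in Metric.ball (0 : EuclideanSpace ℝ (Fin 3)) (K * Real.sqrt (-t₁)), (3 * inner ℝ z e₁ ^ 2 - ‖z‖ ^ 2) / (4 * Real.pi * ‖z‖ ^ 5) * (LinearMap.trace ℝ (EuclideanSpace ℝ (Fin 3)) ((fderiv ℝ (u₁ t₁) x₁).comp (fderiv ℝ (u₁ t₁) x₁)).toLinearMap - LinearMap.trace ℝ (EuclideanSpace ℝ (Fin 3)) ((fderiv ℝ (u₁ t₁)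 (x₁ - z)).comp (fderiv ℝ (u₁ t₁) (x₁ - z))).toLinearMap)) + ((-t₁) ^ 2 * ‖curl (u₁ t₁) x₁‖ ^ 2 - ((-t₁) * inner ℝ (curl (u₁ t₁) x₁) e₁) ^ 2) / 12 - ((-t₁) * inner ℝ (curl (u₁ t₁) x₁) e₁) ^ 2 / 6 ≤ M ^ 2 / 3 + M * (1 - 2 * m / 3) - 2 * m ^ 2 / 3 - δ) ∧ (∀ (C m : ℝ) (u : ℝ → EuclideanSpace ℝ (Fin 3) → EuclideanSpace ℝ (Fin 3)) (t₀ : ℝ) (x₀ : EuclideanSpace ℝ (Fin 3)), t₀ < 0 → (IsTypeIAncientMild C u ∧ (∀ (x₀ : EuclideanSpace ℝ (Fin 3)) (t₀ r : ℝ), t₀ ≤ 0 → 0 < r → (∀ t, t₀ - r^2 < t → t < t₀ → r⁻¹ * ∫ x in Metric.ball x₀ r, ‖u t x‖^2 ≤ C) ∧ r⁻¹ * ∫ t in Set.Ioo (t₀ - r^2) t₀, ∫ x in Metric.ball x₀ r, ‖fderiv ℝ (u t) x‖^2 ≤ C)) → m ≤ lerayMiddleStrain u t₀ x₀ → (∀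 v : ℝ → EuclideanSpace ℝ (Fin 3) → EuclideanSpace ℝ (Fin 3), (IsTypeIAncientMild C v ∧ (∀ (x₀ : EuclideanSpace ℝ (Fin 3)) (t₀ r : ℝ), t₀ ≤ 0 → 0 < r → (∀ t, t₀ - r^2 < t → t < t₀ → r⁻¹ * ∫ x in Metric.ball x₀ r, ‖v t x‖^2 ≤ C) ∧ r⁻¹ * ∫ t in Set.Ioo (t₀ - r^2) t₀, ∫ x in Metric.ball x₀ r, ‖fderiv ℝ (v t) x‖^2 ≤ C)) → ∀ t < 0, ∀ x : EuclideanSpace ℝ (Fin 3), lerayMiddleStrain v t x ≤ m) → 1 / 8 ≤ m → 1 / 3 < m → ∀ (u₁ : ℝ → EuclideanSpace ℝ (Fin 3) → EuclideanSpace ℝ (Fin 3)) (t₁ : ℝ) (x₁ e₁ : EuclideanSpace ℝ (Fin 3)) (M : ℝ), ((IsTypeIAncientMild C u₁ ∧ (∀ (x₀ : EuclideanSpace ℝ (Fin 3)) (t₀ r : ℝ), t₀ ≤ 0 → 0 < r → (∀ t, t₀ - r^2 < t → t < t₀ → r⁻¹ * ∫ x in Metric.ball x₀ r, ‖u₁ t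 x‖^2 ≤ C) ∧ r⁻¹ * ∫ t in Set.Ioo (t₀ - r^2) t₀, ∫ x in Metric.ball x₀ r, ‖fderiv ℝ (u₁ t) x‖^2 ≤ C)) ∧ t₁ < 0 ∧ ‖e₁‖ = 1 ∧ (-t₁) * inner ℝ (fderiv ℝ (u₁ t₁) x₁ e₁) e₁ = M ∧ (∀ v : ℝ → EuclideanSpace ℝ (Fin 3) → EuclideanSpace ℝ (Fin 3), (IsTypeIAncientMild C v ∧ (∀ (x₀ : EuclideanSpace ℝ (Fin 3)) (t₀ r : ℝ), t₀ ≤ 0 → 0 < r → (∀ t, t₀ - r^2 < t → t < t₀ → r⁻¹ * ∫ x in Metric.ball x₀ r, ‖v t x‖^2 ≤ C) ∧ r⁻¹ * ∫ t in Set.Ioo (t₀ - r^2) t₀, ∫ x in Metric.ball x₀ r, ‖fderiv ℝ (v t) x‖^2 ≤ C)) → ∀ t < 0, ∀ (x e : EuclideanSpace ℝ (Fin 3)), ‖e‖ = 1 → (-t) * inner ℝ (fderiv ℝ (v t) x e) e ≤ M)) → 3 * m ≤ M)) := by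
  constructor
  · intro hX
    have hL : SqueezeCycle.SqueezeLiouville :=
      (crux_iff_squeezeLiouville squeezeCycle_mustSqueeze_proof).1 hX
    refine ⟨coaxialFeederExclusion_of_squeezeLiouville hL, ?_⟩
    intro C m u t₀ x₀ ht₀ hu hΛ0 hΛmax hm _
    exact noPancakeRecord_of_squeezeLiouville hL C m u t₀ x₀ ht₀ hu hΛ0 hΛmax hm
  · rintro ⟨hCF, hNP⟩
    exact extremalBiaxialitySubcritical_of_coaxialFeederExclusion_of_noPancakeRecord hCF hNP

end Summit.NavierStokesRegularity.NavierStokesRegularity.Theorems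

end
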